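import Summits.CriticalPhenomena.PercolationContinuityZ3.Theorems.AdditiveGluing.Negative.CertWeighted

/-!
# `NoHeavyLowerTail` (crux stmt-CriticalPhenomena-4575): the WORST-PAIR EXCHANGE is FALSE —
# a certified weighted counterexample on five vertices

The support file `PercNearOneGluingNoHeavyLowerTailWorstPairExchange.lean` (prover prim-gen-kcluster,
2026-08-18) reduces event gluing, `AdditiveGluing` (stmt-4576) and the crux `NoHeavyLowerTail` (stmt-4575)
to ONE conjectured product inequality, the registered stub `stub_worstPairExchange` ("WPE", the
hypothesis `hWPE` of `noHeavyLowerTail_of_worstPairExchange`): for `μ = prodBernoulli w` on `Fin n`, an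
observer `o`, a sink `c`, a relay set `A` and, for `x ∈ A`,

* `S_x := μ(o ↮ x, o ↮ c, o ↔ A ∖ {x})`, `T_x := μ(o ↮ x, x ↮ c)`, `d_x := μ(x ↮ c)`,

WPE asserts `S_a · S_b ≤ T_a · T_b` whenever `a ≠ b ∈ A` are two WORST relays (`d_x ≤ min (d_a, d_b)`
for every other `x ∈ A`).  For `A = {a, b}` it is a theorem (`worstPairExchange_two`, from BHK 2006
Thm 1.5).  THIS FILE SHOWS THAT WPE FAILS FOR `|A| = 3`:

**Witness.**  Vertices `Fin 5`, observer `o = 0`, sink `c = 1`, relays `A = {2, 3, 4}`,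
`a = 2`, `b = 3`; edge weights `w(2,3) = w(0,3) = 99/100`, `w(2,4) = 147/1000`, `w(1,4) = 893/1000`,
`w(0,4) = 1/2`, `w(1,2) = 22/25`, all other pairs weight `0`.  Exactly (64 configurations, rational
arithmetic, evaluated in the kernel-checked compiler by `native_decide`):

* `d_2 = 29726622213/5·10¹¹ ≈ 0.05945`, `d_3 = 31960952051/5·10¹¹ ≈ 0.06392`,
  `d_4 = 13449602219/2.5·10¹¹ ≈ 0.05380` — so `{2, 3}` IS the worst pair (`d_4 ≤ d_2`, `d_4 ≤ d_3`);
* `S_2 ≈ 5.858·10⁻³`, `S_3 ≈ 4.564·10⁻⁴`, `T_2 ≈ 2.056·10⁻³`, `T_3 ≈ 1.123·10⁻³`, and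
  `S_2 S_3 = 26739472799028223/10²² ≈ 2.674·10⁻⁶ > T_2 T_3 = 576999677682634269/2.5·10²³ ≈ 2.308·10⁻⁶`
  (ratio `≈ 1.159`).

Mechanism: the relays `2, 3` are glued to the observer with probability `≈ 0.98` (path `0–3–2` of two
`0.99`-edges), the third relay `4` is the best-connected one; on the rare event that the glue fails, the
pocket events `S_2, S_3` are driven by `o ↔ 4`, and the product of the two pocket probabilities beats the
product of the two "isolated and cut" probabilities `T_2, T_3`.  Found by the seat's exact hill-climb
(`work/py/wpe_search.py`, soft-constrained objective, exact re-verification in `ℚ`), re-verified by an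
independent enumeration.  EVENT GLUING itself (`μ(o ↮ c, o ↔ A) ≤ max_x d_x`) HOLDS at this witness
(`0.06326 ≤ 0.06392`): only the product route to it is refuted, not event gluing, `AdditiveGluing` or the
crux.

Contents: the generic evaluation lemma `real_eq_wcount` (probability of any event whose per-configuration indicator is a `Bool` test on the reach
tables = the exact weighted count; a repackaging of `prodBernoulli_real_eq_wsum` + `cast_sum_wtabs_pos` of
`CertWeighted.lean`), the identification of `S_2, S_3, T_x` with such counts (`real_pocket_two`,
`real_pocket_three`, `real_cut`), the reduction `violation_of_checks` (two decidable rational facts ⇒ the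
violating instance), and the two deliverables `worstPairExchange_cex` (the instance, as an `∃ w` over
`Fin 5`) and `worstPairExchange_false` (`¬ WPE`, WPE written VERBATIM as the hypothesis `hWPE`
of `noHeavyLowerTail_of_worstPairExchange`).  Computational file (`native_decide` on the 64-term rational
sums, as in `PercNearOneGluingNoHeavyLowerTailLinearInclusiveCex.lean`).  No sorries, no definitions.
-/

namespace Summit.CriticalPhenomena.PercolationContinuityZ3.Theorems

open MeasureTheory
open Literature.Probability.LatticeModels Literature.Probability.Percolation
open Summit.CriticalPhenomena.PercolationContinuityZ3.Theorems.AdditiveGluing.Negative.Cert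

namespace WorstPairExchangeCex

/-- **Evaluation lemma.** Under `prodBernoulli (wOfList l)` the probability of any event `D` whose
per-configuration indicator is a `Bool` test `f` on the reach table equals the exact weighted count of
`f` over the `2^m` sub-configurations (`prodBernoulli_real_eq_wsum` + `cast_sum_wtabs_pos`). [folklore] -/
theorem real_eq_wcount {n : ℕ} {l : List (Fin n × Fin n × ℚ)} (hnd : (wPairs l).Nodup)
    (hq : ∀ e ∈ l, 0 ≤ e.2.2 ∧ e.2.2 ≤ 1) (f : List ℕ → Bool) (D : Set (Set (Sym2 (Fin n))))
    (hfD : ∀ ω : List (Fin n × Fin n), f (reachTable n ω) = true ↔ (↑(Eset ω) : Set (Sym2 (Fin n))) ∈ D) :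
    (prodBernoulli (wOfList l)).real D =
      ((((wtabs n l).map fun t => if f t.1 then t.2 else 0).sum : ℚ) : ℝ) := by
  classical
  rw [prodBernoulli_real_eq_wsum hnd hq D]
  exact (cast_sum_wtabs_pos l f (fun S => (↑S : Set (Sym2 (Fin n))) ∈ D) hfD).symm

/-- `({2,3,4} : Finset (Fin 5)).erase 2 = {3, 4}`. [this file] -/
theorem erase_two : (({2, 3, 4} : Finset (Fin 5)).erase 2) = {3, 4} := by decide

/-- `({2,3,4} : Finset (Fin 5)).erase 3 = {2, 4}`. [this file] -/
theorem erase_three : (({2, 3, 4} : Finset (Fin 5)).erase 3) = {2, 4} := by decide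

/-- `S_2` of the witness as an exact weighted count. [this file] -/
theorem real_pocket_two {l : List (Fin 5 × Fin 5 × ℚ)} (hnd : (wPairs l).Nodup)
    (hq : ∀ e ∈ l, 0 ≤ e.2.2 ∧ e.2.2 ≤ 1) :
    (prodBernoulli (wOfList l)).real
        ((openConn (0 : Fin 5) (2 : Fin 5) : Set (BondConfig (Fin 5)))ᶜ ∩ (openConn (0 : Fin 5) (1 : Fin 5))ᶜ ∩
          ⋃ y ∈ ({2, 3, 4} : Finset (Fin 5)).erase 2, openConn (0 : Fin 5) y) =
      ((((wtabs 5 l).map fun t => if (!(t.1.getD 0 0).testBit 2 && !(t.1.getD 0 0).testBit 1 &&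
        ((t.1.getD 0 0).testBit 3 || (t.1.getD 0 0).testBit 4)) then t.2 else 0).sum : ℚ) : ℝ) := by
  rw [erase_two]
  refine real_eq_wcount hnd hq (fun tb => !(tb.getD 0 0).testBit 2 && !(tb.getD 0 0).testBit 1 &&
    ((tb.getD 0 0).testBit 3 || (tb.getD 0 0).testBit 4)) _ fun ω => ?_
  simp only [Bool.and_eq_true, Bool.not_eq_true', Bool.or_eq_true, Set.mem_inter_iff, Set.mem_compl_iff,
    Finset.set_biUnion_insert, Finset.set_biUnion_singleton, Set.mem_union]
  simp only [← testBit_reachTable_iff_mem_openConn, Bool.not_eq_true]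
  rfl

/-- `S_3` of the witness as an exact weighted count. [this file] -/
theorem real_pocket_three {l : List (Fin 5 × Fin 5 × ℚ)} (hnd : (wPairs l).Nodup)
    (hq : ∀ e ∈ l, 0 ≤ e.2.2 ∧ e.2.2 ≤ 1) :
    (prodBernoulli (wOfList l)).real
        ((openConn (0 : Fin 5) (3 : Fin 5) : Set (BondConfig (Fin 5)))ᶜ ∩ (openConn (0 : Fin 5) (1 : Fin 5))ᶜ ∩
          ⋃ y ∈ ({2, 3, 4} : Finset (Fin 5)).erase 3, openConn (0 : Fin 5) y) =
      ((((wtabs 5 l).map fun t => if (!(t.1.getD 0 0).testBit 3 && !(t.1.getD 0 0).testBit 1 &&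
        ((t.1.getD 0 0).testBit 2 || (t.1.getD 0 0).testBit 4)) then t.2 else 0).sum : ℚ) : ℝ) := by
  rw [erase_three]
  refine real_eq_wcount hnd hq (fun tb => !(tb.getD 0 0).testBit 3 && !(tb.getD 0 0).testBit 1 &&
    ((tb.getD 0 0).testBit 2 || (tb.getD 0 0).testBit 4)) _ fun ω => ?_
  simp only [Bool.and_eq_true, Bool.not_eq_true', Bool.or_eq_true, Set.mem_inter_iff, Set.mem_compl_iff,
    Finset.set_biUnion_insert, Finset.set_biUnion_singleton, Set.mem_union]
  simp only [← testBit_reachTable_iff_mem_openConn, Bool.not_eq_true]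
  rfl

/-- `T_x` of the witness as an exact weighted count. [this file] -/
theorem real_cut {l : List (Fin 5 × Fin 5 × ℚ)} (hnd : (wPairs l).Nodup)
    (hq : ∀ e ∈ l, 0 ≤ e.2.2 ∧ e.2.2 ≤ 1) (x : Fin 5) :
    (prodBernoulli (wOfList l)).real
        ((openConn (0 : Fin 5) x : Set (BondConfig (Fin 5)))ᶜ ∩ (openConn x (1 : Fin 5))ᶜ) =
      ((((wtabs 5 l).map fun t => if (!(t.1.getD 0 0).testBit x && !(t.1.getD x 0).testBit 1) then t.2 else 0).sum :
        ℚ) : ℝ) := by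
  refine real_eq_wcount hnd hq (fun tb => !(tb.getD 0 0).testBit x && !(tb.getD x 0).testBit 1) _
    fun ω => ?_
  simp only [Bool.and_eq_true, Bool.not_eq_true', Set.mem_inter_iff, Set.mem_compl_iff]
  simp only [← testBit_reachTable_iff_mem_openConn, Bool.not_eq_true]
  rfl

/-- **From two checkable rational facts to a violating instance.**  For a weighted edge list `l` on
`Fin 5` (distinct pairs, weights in `[0,1]`): if the exact counts say `d_4 ≤ d_2`, `d_4 ≤ d_3`
(`wNotConn`) and `T_2 · T_3 < S_2 · S_3` (the cut and pocket counts), then under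
`prodBernoulli (wOfList l)` with `o = 0`, `c = 1`, `A = {2, 3, 4}` the relays `a = 2`, `b = 3` are the
two worst ones and `S_2 S_3 > T_2 T_3`. [this file] -/
theorem violation_of_checks (l : List (Fin 5 × Fin 5 × ℚ)) (hnd : (wPairs l).Nodup)
    (hq : ∀ e ∈ l, 0 ≤ e.2.2 ∧ e.2.2 ≤ 1)
    (hworst : wNotConn (wtabs 5 l) 4 1 ≤ wNotConn (wtabs 5 l) 2 1 ∧
      wNotConn (wtabs 5 l) 4 1 ≤ wNotConn (wtabs 5 l) 3 1)
    (hgt : ((wtabs 5 l).map fun t => if (!(t.1.getD 0 0).testBit 2 && !(t.1.getD 2 0).testBit 1)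
          then t.2 else 0).sum *
        ((wtabs 5 l).map fun t => if (!(t.1.getD 0 0).testBit 3 && !(t.1.getD 3 0).testBit 1)
          then t.2 else 0).sum <
        ((wtabs 5 l).map fun t => if (!(t.1.getD 0 0).testBit 2 && !(t.1.getD 0 0).testBit 1 &&
          ((t.1.getD 0 0).testBit 3 || (t.1.getD 0 0).testBit 4)) then t.2 else 0).sum *
        ((wtabs 5 l).map fun t => if (!(t.1.getD 0 0).testBit 3 && !(t.1.getD 0 0).testBit 1 &&
          ((t.1.getD 0 0).testBit 2 || (t.1.getD 0 0).testBit 4)) then t.2 else 0).sum) :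
    (∀ x ∈ ({2, 3, 4} : Finset (Fin 5)), x ≠ 2 → x ≠ 3 →
      (prodBernoulli (wOfList l)).real (openConn x (1 : Fin 5) : Set (BondConfig (Fin 5)))ᶜ ≤
          (prodBernoulli (wOfList l)).real (openConn (2 : Fin 5) (1 : Fin 5) : Set (BondConfig (Fin 5)))ᶜ ∧
        (prodBernoulli (wOfList l)).real (openConn x (1 : Fin 5) : Set (BondConfig (Fin 5)))ᶜ ≤
          (prodBernoulli (wOfList l)).real (openConn (3 : Fin 5) (1 : Fin 5) : Set (BondConfig (Fin 5)))ᶜ) ∧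
    (prodBernoulli (wOfList l)).real
        ((openConn (0 : Fin 5) (2 : Fin 5) : Set (BondConfig (Fin 5)))ᶜ ∩ (openConn (2 : Fin 5) (1 : Fin 5))ᶜ) *
      (prodBernoulli (wOfList l)).real
        ((openConn (0 : Fin 5) (3 : Fin 5) : Set (BondConfig (Fin 5)))ᶜ ∩ (openConn (3 : Fin 5) (1 : Fin 5))ᶜ) <
    (prodBernoulli (wOfList l)).real
        ((openConn (0 : Fin 5) (2 : Fin 5) : Set (BondConfig (Fin 5)))ᶜ ∩ (openConn (0 : Fin 5) (1 : Fin 5))ᶜ ∩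
          ⋃ y ∈ ({2, 3, 4} : Finset (Fin 5)).erase 2, openConn (0 : Fin 5) y) *
      (prodBernoulli (wOfList l)).real
        ((openConn (0 : Fin 5) (3 : Fin 5) : Set (BondConfig (Fin 5)))ᶜ ∩ (openConn (0 : Fin 5) (1 : Fin 5))ᶜ ∩
          ⋃ y ∈ ({2, 3, 4} : Finset (Fin 5)).erase 3, openConn (0 : Fin 5) y) := by
  refine ⟨fun x hx hx2 hx3 => ?_, ?_⟩
  · have hx4 : x = 4 := by
      simp only [Finset.mem_insert, Finset.mem_singleton] at hx
      rcases hx with rfl | rfl | rfl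
      · exact absurd rfl hx2
      · exact absurd rfl hx3
      · rfl
    subst hx4
    rw [real_compl_openConn_eq_wNotConn hnd hq, real_compl_openConn_eq_wNotConn hnd hq,
      real_compl_openConn_eq_wNotConn hnd hq]
    exact ⟨by exact_mod_cast hworst.1, by exact_mod_cast hworst.2⟩
  · rw [real_pocket_two hnd hq, real_pocket_three hnd hq, real_cut hnd hq, real_cut hnd hq]
    exact_mod_cast hgt

end WorstPairExchangeCex

open WorstPairExchangeCex

/-- **The worst-pair exchange fails on five vertices.**  There is a weight function `w` on the pairs of
`Fin 5` — namely `w(2,3) = w(0,3) = 99/100`, `w(2,4) = 147/1000`, `w(1,4) = 893/1000`, `w(0,4) = 1/2`,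
`w(1,2) = 22/25`, all other pairs `0` — such that for `μ = prodBernoulli w`, `o = 0`, `c = 1`,
`A = {2, 3, 4}`: the relay `4` has `d_4 ≤ d_2` and `d_4 ≤ d_3` (so `a = 2`, `b = 3` are the two worst
relays), and nevertheless `T_2 · T_3 < S_2 · S_3` (`≈ 2.308·10⁻⁶ < 2.674·10⁻⁶`; exact rationals by
`native_decide`). [this file] -/
theorem worstPairExchange_cex : ∃ w : Sym2 (Fin 5) → unitInterval,
    (∀ x ∈ ({2, 3, 4} : Finset (Fin 5)), x ≠ 2 → x ≠ 3 →
      (prodBernoulli w).real (openConn x (1 : Fin 5) : Set (BondConfig (Fin 5)))ᶜ ≤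
          (prodBernoulli w).real (openConn (2 : Fin 5) (1 : Fin 5) : Set (BondConfig (Fin 5)))ᶜ ∧
        (prodBernoulli w).real (openConn x (1 : Fin 5) : Set (BondConfig (Fin 5)))ᶜ ≤
          (prodBernoulli w).real (openConn (3 : Fin 5) (1 : Fin 5) : Set (BondConfig (Fin 5)))ᶜ) ∧
    (prodBernoulli w).real
        ((openConn (0 : Fin 5) (2 : Fin 5) : Set (BondConfig (Fin 5)))ᶜ ∩ (openConn (2 : Fin 5) (1 : Fin 5))ᶜ) *
      (prodBernoulli w).real
        ((openConn (0 : Fin 5) (3 : Fin 5) : Set (BondConfig (Fin 5)))ᶜ ∩ (openConn (3 : Fin 5) (1 : Fin 5))ᶜ) <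
    (prodBernoulli w).real
        ((openConn (0 : Fin 5) (2 : Fin 5) : Set (BondConfig (Fin 5)))ᶜ ∩ (openConn (0 : Fin 5) (1 : Fin 5))ᶜ ∩
          ⋃ y ∈ ({2, 3, 4} : Finset (Fin 5)).erase 2, openConn (0 : Fin 5) y) *
      (prodBernoulli w).real
        ((openConn (0 : Fin 5) (3 : Fin 5) : Set (BondConfig (Fin 5)))ᶜ ∩ (openConn (0 : Fin 5) (1 : Fin 5))ᶜ ∩
          ⋃ y ∈ ({2, 3, 4} : Finset (Fin 5)).erase 3, openConn (0 : Fin 5) y) :=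
  ⟨_, violation_of_checks
    [(2, 3, 99/100), (0, 3, 99/100), (2, 4, 147/1000), (1, 4, 893/1000), (0, 4, 1/2), (1, 2, 22/25)]
    (by decide)
    (by
      intro e he
      simp only [List.mem_cons, List.not_mem_nil, or_false] at he
      rcases he with rfl | rfl | rfl | rfl | rfl | rfl <;> norm_num)
    (by native_decide) (by native_decide)⟩

/-- **The worst-pair exchange (stub `stub_worstPairExchange` of crux stmt-CriticalPhenomena-4575) is
FALSE.**  The negated statement is, verbatim, the hypothesis `hWPE` of
`noHeavyLowerTail_of_worstPairExchange` / `eventGluing_of_worstPairExchange`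
(`PercNearOneGluingNoHeavyLowerTailWorstPairExchange.lean`): "for all finite weighted graphs, every relay
set `A`, observer `o`, sink `c` and two worst relays `a ≠ b ∈ A`, `S_a S_b ≤ T_a T_b`".  Witness:
`worstPairExchange_cex` (`n = 5`, `A = {2,3,4}`, `o = 0`, `c = 1`, `a = 2`, `b = 3`).  Consequence for
the route: the `|A| ≥ 3` event-gluing / `NoHeavyLowerTail` reductions through WPE are vacuous; event
gluing itself is NOT refuted here (it holds at the witness, `0.06326 ≤ 0.06392`). [this file] -/
theorem worstPairExchange_false :
    ¬ (∀ (n : ℕ) (w : Sym2 (Fin n) → unitInterval) (A : Finset (Fin n)) (o c a b : Fin n),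
      a ∈ A → b ∈ A → a ≠ b →
      (∀ x ∈ A, x ≠ a → x ≠ b →
        (prodBernoulli w).real (openConn x c : Set (BondConfig (Fin n)))ᶜ ≤
            (prodBernoulli w).real (openConn a c : Set (BondConfig (Fin n)))ᶜ ∧
          (prodBernoulli w).real (openConn x c : Set (BondConfig (Fin n)))ᶜ ≤
            (prodBernoulli w).real (openConn b c : Set (BondConfig (Fin n)))ᶜ) →
      (prodBernoulli w).real
          ((openConn o a : Set (BondConfig (Fin n)))ᶜ ∩ (openConn o c)ᶜ ∩ ⋃ y ∈ A.erase a, openConn o y) *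
        (prodBernoulli w).real
          ((openConn o b : Set (BondConfig (Fin n)))ᶜ ∩ (openConn o c)ᶜ ∩ ⋃ y ∈ A.erase b, openConn o y) ≤
      (prodBernoulli w).real ((openConn o a : Set (BondConfig (Fin n)))ᶜ ∩ (openConn a c)ᶜ) *
        (prodBernoulli w).real ((openConn o b : Set (BondConfig (Fin n)))ᶜ ∩ (openConn b c)ᶜ)) := by
  intro h
  obtain ⟨w, hworst, hgt⟩ := worstPairExchange_cex
  have hle := h 5 w {2, 3, 4} 0 1 2 3 (by decide) (by decide) (by decide) hworst
  exact absurd hle (not_le.2 hgt)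

end Summit.CriticalPhenomena.PercolationContinuityZ3.Theorems
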